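import Literature.Geometry.Kaehler.ComplexTorusAnalyticFibreFormulaWeighted
import Literature.Geometry.Kaehler.ComplexTorusAnalyticClassesRing
import Literature.Geometry.Kaehler.ComplexTorusChainPeriodicStokes
import Literature.Geometry.GeometricMeasureTheory.CurrentsConstancy
import Literature.LinearAlgebra.Alternating.WedgeOneWedgeCalculus
import HarnessLib

/-!
# The class of the generic fibre of an analytic subset of `X₁ × X₂` is the restriction of its class

Layer `Literature/Geometry/Kaehler`, namespace `Literature.Geometry.Kaehler.ComplexTorus`; lane
`lit-hodgefound`, seat p07, programme «THE GENERIC FIBRE CLASS IS THE RESTRICTION OF THE CLASS, AND THE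
MOVING LEMMA ON A COMPLEX TORUS», file 2 (file 1: `ComplexTorusAnalyticFibreFormulaWeighted.lean`).

Let `X = X₁ × X₂ = (E₁ ⊞ E₂)/(Λ₁ ⊕ Λ₂)` be the Euclidean product of two complex tori and `Z ⊆ X` a
closed analytic subset of pure dimension `q + dim X₂` (`0 < q`), with slices
`Z_t = {x̄ ∈ X₁ | (x̄, π₂ t) ∈ Z}` (`t ∈ E₂`), for a.e. `t` empty or of pure dimension `q`
(`ComplexTorus.ae_hasPureDim_fibreSlice`). Fulton, *Intersection Theory*, §10.1: for a family of
cycles the specializations `α_t` satisfy "`α_t = i_t^*(α)`" (Example 10.1.2) and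
"`[𝒱]_t = Σ eᵢ [Wᵢ]`" over the components of the fibre with the multiplicities of `𝒱` along `V_t`
(Example 10.1.1), the multiplicities being `1` at a general `t`; Prop. 10.2 (conservation of number):
"the cycle classes `α_t` … all have the same degree". In the language of currents: the slices
`⟨[Z], pr₂, t⟩ = [Z_t]` (a.e. `t`) of the closed current `[Z]` are closed and cohomologous to each
other [Federer1969, 4.3.1–4.3.2], [King1971, §3]. We prove, in the tree's model
`Hᵏ(X, ℂ) = Altᵏ_ℝ(E; ℂ)` of the cohomology of a complex torus:

* §1 **`ae_eq_const_of_forall_integral_fderiv_mul_eq_zero`** (analysis): a function `θ : V → ℝ`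
  (or `→ ℂ`) on a finite-dimensional real vector space, integrable on every ball and with ZERO
  DISTRIBUTIONAL GRADIENT (`∫ (D_v g) θ = 0` for all smooth compactly supported `g` and all `v`) is
  a.e. CONSTANT — Federer's constancy theorem 4.1.4/4.1.7 in the form `ZeroGradient.exists_const` of
  the tree, exhausted over balls.
* §2 (algebra) **`wedgeOne_cross_curryLeft`**: for a `2a`-form `γ` on `V₁`, a top-degree form `ν` on
  `V₂`, a real covector `ℓ` of `V₂` and `v ∈ V₂`,
  `(ℓ ∘ pr₂) ∧ (pr₁^*γ ∧ pr₂^*(v ⌟ ν)) = ℓ(v) · (pr₁^*γ ∧ pr₂^*ν)` (graded commutativity past the even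
  form `pr₁^*γ` [Warner1983, 2.6] and the antiderivation rule `v ⌟ (ℓ ∧ ν) = ℓ(v) ν - ℓ ∧ (v ⌟ ν)`
  [Warner1983, 2.11], `ℓ ∧ ν = 0` in degree `> dim`).
* §3 **`setIntegral_slab_wedgeOne_fderiv_eq_zero`** (Stokes): for the chain `[π⁻¹Z]` of the lift of
  `Z`, a smooth compactly supported `φ : E₂ → ℝ` and a constant form `Θ` of degree `2 dim Z - 1`,
  `∫_{reg π⁻¹Z ∩ (Φ₁[0,1)^ι₁ × E₂)} (d(φ ∘ pr₂) ∧ Θ)(ξ) d𝓗 = 0` — Stokes' theorem over the slab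
  fundamental domain of `Λ₁ ⊕ 0` (`HolomorphicChain.setIntegral_slab_density_mul_extDeriv_apply_eq_zero`,
  i.e. Harvey's `d[π⁻¹Z] = 0` unfolded) for the `Λ₁ ⊕ 0`-periodic form `(φ ∘ pr₂) Θ`, bounded in the
  `E₂`-directions; hence, with §2 and the weighted fibre formula of file 1,
  **`integral_fderiv_mul_fibreSlicePeriod_eq_zero`**: `∫_{E₂} (∂_v φ)(t) (∫_{Z_t} γ) dt = 0` — the
  fibre period `F_γ(t) = ∫_{Z_t} γ` has zero distributional gradient.
* §4 **THE GENERIC FIBRE CLASS IS CONSTANT**: `F_γ` is a.e. equal to a constant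
  (`ae_eq_const_fibreSlicePeriod`); the class-valued function `t ↦ cl_{e₁}(Z_t) := setCycleClass Φ₁ e₁ _ Z_t`
  is a.e. equal to ONE class `R ∈ H^{2p}(X₁, ℂ)` (`exists_ae_setCycleClass_fibreSlice_eq`), and
  **`ae_setCycleClass_fibreSlice_eq_inl_pullback`**: `R = sign(e₁) sign(e) · i₀^*[Z]_e`, i.e. for a.e.
  `t` the class of the slice `Z_t ⊆ X₁` (taken `0` when the slice is empty) is the restriction
  `i₀^*[Z]` of the class of `Z` along `i₀ : X₁ → X₁ × X₂`, `x ↦ (x, 0)` (homotopic to every `i_t`),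
  up to the orientation signs of the two Poincaré dualities (`sign(e') [·]_{e'}` is orientation-free,
  `orientationSign_smul_analyticCycleClass`): Fulton's `α_t = i_t^* α` with all multiplicities one for
  a.e. `t`. The constant is pinned by the unweighted fibre formula over a period box
  (`analyticCyclePeriod_cross_eq_integral_fibreSlice`), the Gysin identity
  `⟨γ, i₀^*β⟩ = ± ⟨pr₁^*γ ∧ pr₂^*vol, β⟩` (`poincarePairing_compContinuousLinearMap_inl_eq`) and the
  normalisation `vol(e₂, ie₂, …) · 𝓗(Φ₂[0,1)^ι₂) = ∫_{X₂} vol = 1`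
  (`apply_complexFrame_mul_measure_periodBox`). Consequence
  (`ae_fibreSlice_eq_empty_or_ae_hasPureDim`): EITHER a.e. slice is empty (and `i₀^*[Z] = 0`) OR
  a.e. slice is of pure dimension `q` with class `± i₀^*[Z] ≠ 0`.

Theorems only; no definitions, no instances, no named facts.

## References

* [Fulton1998] W. Fulton, *Intersection Theory*, 2nd ed., Springer 1998, §10.1 (Cor. 10.1,
  Examples 10.1.1, 10.1.2), §10.2 Prop. 10.2, §19.2 Cor. 19.2 (b).
* [Federer1969] H. Federer, *Geometric Measure Theory*, Springer 1969, 4.1.4, 4.1.7 (constancy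
  theorem), 4.3.1–4.3.2 (slicing), 3.2.22.
* [King1971] J. R. King, *The currents defined by analytic varieties*, Acta Math. 127 (1971) 185–220, §3.
* [Warner1983] F. W. Warner, *Foundations of Differentiable Manifolds and Lie Groups*, Springer GTM 94
  (1983), 2.6, 2.11.
* [VoisinHodgeI2002] C. Voisin, *Hodge Theory and Complex Algebraic Geometry I*, CUP 2002, §11.1.2,
  Thm. 11.21.
* [Lange2023AbelianVarietiesComplex] H. Lange, *Abelian Varieties over the Complex Numbers*, Springer
  2023, §1.1.1, §6.2.4 (6.10).
-/

noncomputable section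

open scoped Manifold Topology ENNReal NNReal ContDiff
open MeasureTheory MeasureTheory.Measure Set Function Filter Module TopologicalSpace WithLp Metric
open Literature.Geometry.GeometricMeasureTheory Literature.Analysis.Complex Literature.LinearAlgebra.Alternating

universe u

namespace Literature.Geometry.Kaehler

-- Nested operator-norm instances on `V [⋀^Fin m]→L[ℝ] F`, as in the tree's `Currents*.lean` files.
set_option maxSynthPendingDepth 2

/-! ### §1 Zero distributional gradient on the whole space forces an a.e. constant -/

section ZeroGradient

variable {V : Type*} [NormedAddCommGroup V] [NormedSpace ℝ V] [FiniteDimensional ℝ V]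
  [MeasurableSpace V] [BorelSpace V] (ν : Measure V) [ν.IsAddHaarMeasure]

/-- **A locally integrable function with zero distributional gradient is a.e. constant** (real
values): if `θ` is integrable on every ball and `∫ (D_v g) θ dν = 0` for all smooth compactly supported
`g` and all directions `v`, then `θ = c` a.e. for a constant `c` — Federer's constancy theorem
(the tree's `ZeroGradient.exists_const`, proved by mollification) applied on an exhausting sequence of
balls. [cite: Federer1969, 4.1.4 and 4.1.7] -/
theorem ae_eq_const_of_forall_integral_fderiv_mul_eq_zero {θ : V → ℝ}
    (hθ : ∀ R : ℝ, IntegrableOn θ (closedBall (0 : V) R) ν)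
    (H : ∀ g : V → ℝ, ContDiff ℝ ∞ g → HasCompactSupport g → ∀ v : V, ∫ y, fderiv ℝ g y v * θ y ∂ν = 0) :
    ∃ c : ℝ, θ =ᵐ[ν] fun _ ↦ c := by
  -- the constancy theorem on the ball `B(0, n+1)`, for the finite measure `ν ⌞ B̄(0, n+2)`
  have hstep : ∀ n : ℕ, ∃ c : ℝ, ∀ A : Set V, MeasurableSet A → A ⊆ ball (0 : V) (n + 1) →
      ∫ y in A, θ y ∂ν = c * (ν A).toReal := by
    intro n
    set μ : Measure V := ν.restrict (closedBall (0 : V) (n + 2)) with hμ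
    haveI : IsFiniteMeasure μ := by
      rw [hμ]
      exact isFiniteMeasure_restrict.2 (isCompact_closedBall _ _).measure_lt_top.ne
    have hθμ : Integrable θ μ := hθ _
    have hHyp : ZeroGradient.Hyp μ θ (ball (0 : V) (n + 1)) := by
      intro g hg hgc hgs v
      have hsub : ball (0 : V) (n + 1) ⊆ closedBall (0 : V) (n + 2) :=
        ball_subset_closedBall.trans (closedBall_subset_closedBall (by linarith))
      have hzero : ∀ y, y ∉ closedBall (0 : V) (n + 2) → fderiv ℝ g y v * θ y = 0 := by
        intro y hy
        have hy' : y ∉ tsupport g := fun h ↦ hy (hsub (hgs h))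
        rw [fderiv_of_notMem_tsupport ℝ hy', zero_apply, zero_mul]
      rw [hμ, setIntegral_eq_integral_of_forall_compl_eq_zero fun y hy ↦ hzero y hy]
      exact H g hg hgc v
    obtain ⟨c, hc⟩ := ZeroGradient.exists_const ν μ hθμ hHyp isOpen_ball
      (convex_ball (0 : V) (n + 1)).isPreconnected
    refine ⟨c, fun A hA hAB ↦ ?_⟩
    have h := hc A hA hAB ((measure_mono hAB).trans_lt measure_ball_lt_top).ne
    rw [hμ, Measure.restrict_restrict hA,
      inter_eq_left.2 (hAB.trans (ball_subset_closedBall.trans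
        (closedBall_subset_closedBall (by linarith))))] at h
    exact h
  choose c hc using hstep
  -- all the constants agree with `c 0` (compare on the unit ball)
  have hcc : ∀ n, c n = c 0 := by
    intro n
    have h1 := hc n (ball 0 1) measurableSet_ball (ball_subset_ball (by simp))
    have h0 := hc 0 (ball 0 1) measurableSet_ball (ball_subset_ball (by simp))
    have hpos : (ν (ball (0 : V) 1)).toReal ≠ 0 :=
      (ENNReal.toReal_pos (measure_ball_pos ν 0 one_pos).ne' measure_ball_lt_top.ne).ne'
    exact mul_right_cancel₀ hpos (h1.symm.trans h0)
  refine ⟨c 0, ?_⟩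
  -- `θ = c 0` a.e. on each ball, by uniqueness of densities
  have hball : ∀ n : ℕ, ∀ᵐ y ∂ν, y ∈ ball (0 : V) (n + 1) → θ y = c 0 := by
    intro n
    have hfin : ν (ball (0 : V) (n + 1)) < ⊤ := measure_ball_lt_top
    haveI : IsFiniteMeasure (ν.restrict (ball (0 : V) (n + 1))) :=
      isFiniteMeasure_restrict.2 hfin.ne
    have hθb : Integrable θ (ν.restrict (ball (0 : V) (n + 1))) :=
      (hθ (n + 1)).mono_set ball_subset_closedBall
    have hconst : Integrable (fun _ ↦ c 0) (ν.restrict (ball (0 : V) (n + 1))) := integrable_const _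
    have hae := Integrable.ae_eq_of_forall_setIntegral_eq θ (fun _ ↦ c 0) hθb hconst
      (fun s hs _ ↦ by
        rw [Measure.restrict_restrict hs, hc n (s ∩ ball 0 (n + 1)) (hs.inter measurableSet_ball)
          inter_subset_right, hcc n, setIntegral_const, smul_eq_mul, measureReal_def, mul_comm])
    exact (ae_restrict_iff' measurableSet_ball).1 hae
  have hall := ae_all_iff.2 hball
  filter_upwards [hall] with y hy
  obtain ⟨n, hn⟩ := exists_nat_gt ‖y‖
  exact hy n (mem_ball_zero_iff.2 (hn.trans (by linarith)))

/-- **A locally integrable complex function with zero distributional gradient is a.e. constant**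
(real test functions; real and imaginary parts separately). [cite: Federer1969, 4.1.4 and 4.1.7] -/
theorem ae_eq_const_of_forall_integral_fderiv_mul_eq_zero_complex {θ : V → ℂ}
    (hθ : ∀ R : ℝ, IntegrableOn θ (closedBall (0 : V) R) ν)
    (H : ∀ g : V → ℝ, ContDiff ℝ ∞ g → HasCompactSupport g → ∀ v : V,
      ∫ y, ((fderiv ℝ g y v : ℝ) : ℂ) * θ y ∂ν = 0) :
    ∃ c : ℂ, θ =ᵐ[ν] fun _ ↦ c := by
  haveI : LocallyCompactSpace V := by infer_instance
  -- the products `(D_v g) θ` are integrable (compact support against local integrability)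
  have hloc : LocallyIntegrable θ ν := by
    refine (locallyIntegrable_iff).2 fun k hk ↦ ?_
    obtain ⟨R, hR⟩ := hk.isBounded.subset_closedBall 0
    exact (hθ R).mono_set hR
  have hint : ∀ g : V → ℝ, ContDiff ℝ ∞ g → HasCompactSupport g → ∀ v : V,
      Integrable (fun y ↦ ((fderiv ℝ g y v : ℝ) : ℂ) * θ y) ν := by
    intro g hg hgc v
    have hcont : Continuous fun y ↦ fderiv ℝ g y v :=
      (hg.continuous_fderiv (by simp)).clm_apply continuous_const
    have hsupp : HasCompactSupport fun y ↦ fderiv ℝ g y v :=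
      hgc.fderiv_apply (𝕜 := ℝ) v
    have h := hloc.integrable_smul_left_of_hasCompactSupport hcont hsupp
    refine h.congr (ae_of_all _ fun y ↦ ?_)
    simp only [Complex.real_smul]
  -- real and imaginary parts have zero gradient
  have hre : ∀ g : V → ℝ, ContDiff ℝ ∞ g → HasCompactSupport g → ∀ v : V,
      ∫ y, fderiv ℝ g y v * (θ y).re ∂ν = 0 := by
    intro g hg hgc v
    have h := congrArg Complex.re (H g hg hgc v)
    rw [Complex.zero_re] at h
    rw [← h]
    change _ = Complex.reCLM (∫ y, ((fderiv ℝ g y v : ℝ) : ℂ) * θ y ∂ν)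
    rw [← ContinuousLinearMap.integral_comp_comm _ (hint g hg hgc v)]
    refine integral_congr_ae (ae_of_all _ fun y ↦ ?_)
    simp only [Complex.reCLM_apply, Complex.re_ofReal_mul]
  have him : ∀ g : V → ℝ, ContDiff ℝ ∞ g → HasCompactSupport g → ∀ v : V,
      ∫ y, fderiv ℝ g y v * (θ y).im ∂ν = 0 := by
    intro g hg hgc v
    have h := congrArg Complex.im (H g hg hgc v)
    rw [Complex.zero_im] at h
    rw [← h]
    change _ = Complex.imCLM (∫ y, ((fderiv ℝ g y v : ℝ) : ℂ) * θ y ∂ν)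
    rw [← ContinuousLinearMap.integral_comp_comm _ (hint g hg hgc v)]
    refine integral_congr_ae (ae_of_all _ fun y ↦ ?_)
    simp only [Complex.imCLM_apply, Complex.im_ofReal_mul]
  have hθre : ∀ R : ℝ, IntegrableOn (fun y ↦ (θ y).re) (closedBall (0 : V) R) ν := fun R ↦ by
    have h := (hθ R).re
    simp only [RCLike.re_to_complex] at h
    exact h
  have hθim : ∀ R : ℝ, IntegrableOn (fun y ↦ (θ y).im) (closedBall (0 : V) R) ν := fun R ↦ by
    have h := (hθ R).im
    simp only [RCLike.im_to_complex] at h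
    exact h
  obtain ⟨a, ha⟩ := ae_eq_const_of_forall_integral_fderiv_mul_eq_zero ν hθre hre
  obtain ⟨b, hb⟩ := ae_eq_const_of_forall_integral_fderiv_mul_eq_zero ν hθim him
  refine ⟨⟨a, b⟩, ?_⟩
  filter_upwards [ha, hb] with y hya hyb
  exact Complex.ext hya hyb

end ZeroGradient

/-! ### §2 The covector `ℓ ∘ pr₂` through a cross form: `(ℓ∘pr₂) ∧ (pr₁^*γ ∧ pr₂^*(v ⌟ ν)) = ℓ(v) · pr₁^*γ ∧ pr₂^*ν` -/

section Algebra

variable {V : Type*} [NormedAddCommGroup V] [NormedSpace ℝ V]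
  {W : Type*} [NormedAddCommGroup W] [NormedSpace ℝ W]
  {V₁ : Type*} [NormedAddCommGroup V₁] [NormedSpace ℝ V₁]
  {V₂ : Type*} [NormedAddCommGroup V₂] [NormedSpace ℝ V₂]

/-- **Naturality of `θ ∧ ·` under pull-back**: `(θ ∘ g) ∧ (η ∘ g) = (θ ∧ η) ∘ g`.
[cite: Warner1983, 2.22 (c)] -/
theorem wedgeOne_compContinuousLinearMap {n : ℕ} (θ : V →L[ℝ] ℝ) (η : V [⋀^Fin n]→L[ℝ] ℂ)
    (g : W →L[ℝ] V) :
    wedgeOne (θ.comp g) (η.compContinuousLinearMap g) = (wedgeOne θ η).compContinuousLinearMap g := by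
  ext v
  simp only [LinearAlgebra.Alternating.wedgeOne_apply, ContinuousAlternatingMap.compContinuousLinearMap_apply,
    ContinuousLinearMap.coe_comp, Function.comp_apply]
  rfl

/-- **A real-multilinear alternating form of degree exceeding the real dimension vanishes.**
[cite: Federer1969, 1.4.3] -/
theorem ContinuousAlternatingMap.eq_zero_of_finrank_lt [FiniteDimensional ℝ V] {N : ℕ}
    (η : V [⋀^Fin N]→L[ℝ] ℂ) (h : finrank ℝ V < N) : η = 0 := by
  ext w
  have hnot : ¬ LinearIndependent ℝ w := by
    intro hli
    have := hli.fintype_card_le_finrank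
    rw [Fintype.card_fin] at this
    omega
  simpa using η.toAlternatingMap.map_linearDependent w hnot

/-- **A post-composed `ℝ`-linear functional passes through `θ ∧ ·`**: `L((θ ∧ Θ)(w)) = (θ ∧ (L ∘ Θ))(w)`
(used with `L = re, im` to reduce complex-valued forms to real ones). [cite: Warner1983, 2.6] -/
theorem apply_wedgeOne_eq_wedgeOne_compContinuousAlternatingMap {n : ℕ} (L : ℂ →L[ℝ] ℝ)
    (θ : V →L[ℝ] ℝ) (Θ : V [⋀^Fin n]→L[ℝ] ℂ) (w : Fin (n + 1) → V) :
    L (wedgeOne θ Θ w) = wedgeOne θ (L.compContinuousAlternatingMap Θ) w := by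
  simp only [LinearAlgebra.Alternating.wedgeOne_apply, _root_.map_sum, map_zsmul, map_smul,
    ContinuousLinearMap.compContinuousAlternatingMap_coe, Function.comp_apply]

/-- **`(ℓ ∘ pr₂) ∧ (pr₁^*γ ∧ pr₂^*(v ⌟ ν)) = ℓ(v) · (pr₁^*γ ∧ pr₂^*ν)`** on `V₁ ⊞ V₂`, for an EVEN-degree
form `γ` on `V₁`, a form `ν` on `V₂` of degree `> dim V₂ - 1` (so that `ℓ ∧ ν = 0` for every real
covector `ℓ`), a real covector `ℓ` of `V₂` and `v ∈ V₂`: the covector passes the even form `pr₁^*γ`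
without sign and `ℓ ∧ (v ⌟ ν) = ℓ(v) ν - v ⌟ (ℓ ∧ ν) = ℓ(v) ν`. This is the pointwise identity
`d(φ ∘ pr₂) ∧ (pr₁^*γ ∧ pr₂^*(v ⌟ vol)) = (∂_v φ ∘ pr₂) · pr₁^*γ ∧ pr₂^*vol` behind the zero-gradient
computation of §3. [cite: Warner1983, 2.6 and 2.11] -/
theorem wedgeOne_cross_curryLeft {a k : ℕ} (γ : V₁ [⋀^Fin (2 * a)]→L[ℝ] ℂ) (ν : V₂ [⋀^Fin (k + 1)]→L[ℝ] ℂ)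
    (hν : ∀ θ : V₂ →L[ℝ] ℝ, wedgeOne θ ν = 0) (ℓ : V₂ →L[ℝ] ℝ) (v : V₂) :
    wedgeOne (ℓ.comp ((ContinuousLinearMap.snd ℝ V₁ V₂).comp
        (WithLp.prodContinuousLinearEquiv 2 ℝ V₁ V₂ : WithLp 2 (V₁ × V₂) →L[ℝ] V₁ × V₂)))
      (((γ.compContinuousLinearMap (ContinuousLinearMap.fst ℝ V₁ V₂)).wedge
          ((ν.curryLeft v).compContinuousLinearMap (ContinuousLinearMap.snd ℝ V₁ V₂))).compContinuousLinearMap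
        (WithLp.prodContinuousLinearEquiv 2 ℝ V₁ V₂ : WithLp 2 (V₁ × V₂) →L[ℝ] V₁ × V₂)) =
      (ℓ v : ℝ) • (((γ.compContinuousLinearMap (ContinuousLinearMap.fst ℝ V₁ V₂)).wedge
          (ν.compContinuousLinearMap (ContinuousLinearMap.snd ℝ V₁ V₂))).compContinuousLinearMap
        (WithLp.prodContinuousLinearEquiv 2 ℝ V₁ V₂ : WithLp 2 (V₁ × V₂) →L[ℝ] V₁ × V₂)) := by
  set P := (WithLp.prodContinuousLinearEquiv 2 ℝ V₁ V₂ : WithLp 2 (V₁ × V₂) →L[ℝ] V₁ × V₂) with hP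
  set p₁ := ContinuousLinearMap.fst ℝ V₁ V₂ with hp₁
  set p₂ := ContinuousLinearMap.snd ℝ V₁ V₂ with hp₂
  -- naturality in `P`
  rw [show ℓ.comp (p₂.comp P) = (ℓ.comp p₂).comp P from rfl, wedgeOne_compContinuousLinearMap]
  -- the covector passes the even form `pr₁^*γ`
  have h2 : wedgeOne (ℓ.comp p₂) ((γ.compContinuousLinearMap p₁).wedge
      ((ν.curryLeft v).compContinuousLinearMap p₂)) =
      (γ.compContinuousLinearMap p₁).wedge (wedgeOne (ℓ.comp p₂) ((ν.curryLeft v).compContinuousLinearMap p₂)) := by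
    rw [wedge_wedgeOne, pow_mul, neg_one_sq, one_pow, one_smul]
  -- naturality in `pr₂` and the antiderivation rule
  have h3 : wedgeOne (ℓ.comp p₂) ((ν.curryLeft v).compContinuousLinearMap p₂) =
      ((ℓ v : ℝ) • ν).compContinuousLinearMap p₂ := by
    rw [wedgeOne_compContinuousLinearMap]
    congr 1
    have h := curryLeft_wedgeOne ℓ ν v
    rw [hν ℓ] at h
    have h0 : ((0 : V₂ [⋀^Fin (k + 1 + 1)]→L[ℝ] ℂ).curryLeft v) = 0 := by ext u; simp
    rw [h0] at h
    exact (sub_eq_zero.1 h.symm).symm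
  rw [h2, h3]
  have h4 : ((ℓ v : ℝ) • ν).compContinuousLinearMap p₂ = (ℓ v : ℝ) • ν.compContinuousLinearMap p₂ := by
    ext w; rfl
  rw [h4, ContinuousAlternatingMap.wedge_smul_right]
  ext w
  rfl

end Algebra

namespace ComplexTorus

/-! ### §3 Stokes over the slab `Φ₁([0,1)^ι₁) × E₂` and the zero gradient of the fibre period -/

section Stokes

variable {ι₁ ι₂ : Type*} [Fintype ι₁] [Fintype ι₂] [DecidableEq ι₁] [DecidableEq ι₂]
  {E₁ : Type u} [NormedAddCommGroup E₁] [InnerProductSpace ℂ E₁] [FiniteDimensional ℂ E₁]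
  [MeasurableSpace E₁] [BorelSpace E₁]
  {E₂ : Type u} [NormedAddCommGroup E₂] [InnerProductSpace ℂ E₂] [FiniteDimensional ℂ E₂]
  [MeasurableSpace E₂] [BorelSpace E₂]
  (Φ₁ : (ι₁ → ℝ) ≃L[ℝ] E₁) (Φ₂ : (ι₂ → ℝ) ≃L[ℝ] E₂)

omit [DecidableEq ι₁] [DecidableEq ι₂] [FiniteDimensional ℂ E₁] [MeasurableSpace E₁] [BorelSpace E₁]
  [FiniteDimensional ℂ E₂] [MeasurableSpace E₂] [BorelSpace E₂] in
/-- **The slab of the coordinate directions `ι₁` is `Φ₁([0,1)^ι₁) × E₂`**: for the Euclidean product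
torus and `K = ι₁ ⊂ ι₁ ⊔ ι₂`, `slab (prodPeriodL2 Φ₁ Φ₂) K 0 = {z | z₁ ∈ periodBox Φ₁ 0}`.
[cite: Lange2023AbelianVarietiesComplex, §1.1.1] -/
theorem slab_map_inl_eq :
    slab (prodPeriodL2 Φ₁ Φ₂) ((Finset.univ : Finset ι₁).map ⟨Sum.inl, Sum.inl_injective⟩) 0 =
      {z : WithLp 2 (E₁ × E₂) | (ofLp z).1 ∈ periodBox Φ₁ 0} := by
  ext z
  simp only [mem_slab_iff, Finset.mem_map, Finset.mem_univ, Function.Embedding.coeFn_mk, true_and,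
    forall_exists_index, forall_apply_eq_imp_iff, Pi.zero_apply, zero_add, mem_setOf_eq, mem_periodBox_iff]
  have h1 : ∀ i, (prodPeriodL2 Φ₁ Φ₂).symm z (Sum.inl i) = Φ₁.symm (ofLp z).1 i := fun i ↦ by
    rw [prodPeriodL2_symm_apply]
    exact congrFun (prodPeriod_symm_inl Φ₁ Φ₂ (ofLp z)) i
  simp only [h1]

omit [FiniteDimensional ℂ E₁] [MeasurableSpace E₁] [BorelSpace E₁]
  [FiniteDimensional ℂ E₂] [MeasurableSpace E₂] [BorelSpace E₂] in
/-- **Lattice vectors supported on `ι₁` have second component `0`**: for `m ∈ ℤ^{ι₁}`,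
`(Φ(m ⊕ 0))₂ = 0`. [cite: Lange2023AbelianVarietiesComplex, §1.1.1] -/
theorem snd_latticeVecOn_map_inl (m : ((Finset.univ : Finset ι₁).map ⟨Sum.inl, Sum.inl_injective⟩) → ℤ) :
    (ofLp (latticeVecOn (prodPeriodL2 Φ₁ Φ₂) ((Finset.univ : Finset ι₁).map ⟨Sum.inl, Sum.inl_injective⟩)
      m)).2 = 0 := by
  set y := latticeVecOn (prodPeriodL2 Φ₁ Φ₂) ((Finset.univ : Finset ι₁).map ⟨Sum.inl, Sum.inl_injective⟩) m
    with hy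
  have h : Φ₂.symm (ofLp y).2 = 0 := by
    funext j
    have hj : (Sum.inr j : ι₁ ⊕ ι₂) ∉ (Finset.univ : Finset ι₁).map ⟨Sum.inl, Sum.inl_injective⟩ := by
      simp
    have h1 := symm_latticeVecOn_apply_of_notMem (prodPeriodL2 Φ₁ Φ₂)
      ((Finset.univ : Finset ι₁).map ⟨Sum.inl, Sum.inl_injective⟩) m hj
    rw [prodPeriodL2_symm_apply] at h1
    have h2 := congrFun (prodPeriod_symm_inr Φ₁ Φ₂ (ofLp y)) j
    rw [Pi.zero_apply, ← h2]
    exact h1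
  simpa using congrArg Φ₂ h

/-- **STOKES OVER THE SLAB `Φ₁([0,1)^ι₁) × E₂` for the chain `[π⁻¹Z]` and the form `(φ ∘ pr₂) Θ`**: for
`Z ⊆ X₁ × X₂` closed analytic of pure dimension `m + 1`, a constant complex form `Θ` of degree `2m + 1`
on `E₁ ⊞ E₂` and a smooth compactly supported `φ : E₂ → ℝ`,
`∫_{reg π⁻¹Z ∩ (Φ₁[0,1)^ι₁ × E₂)} (D(φ ∘ pr₂)(z) ∧ Θ)(ξ(z)) d𝓗^{2m+2}(z) = 0`
— the current `[π⁻¹Z]` is closed (Harvey, Lelong) and `(φ ∘ pr₂) Θ` is a smooth `(Λ₁ ⊕ 0)`-periodic form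
bounded in the `E₂`-directions, so Stokes' theorem over the slab fundamental domain applies
(`HolomorphicChain.setIntegral_slab_density_mul_extDeriv_apply_eq_zero`, to the real and imaginary parts).
[cite: VoisinHodgeI2002, §11.1.2 Thm. 11.21] [cite: Federer1969, 4.1.7] -/
theorem setIntegral_slab_wedgeOne_fderiv_eq_zero {m : ℕ} {Z : Set (ComplexTorus (prodPeriodL2 Φ₁ Φ₂))}
    (hZ : HasPureDim 𝓘(ℂ, WithLp 2 (E₁ × E₂)) Z (m + 1))
    (Θ : WithLp 2 (E₁ × E₂) [⋀^Fin (2 * m + 1)]→L[ℝ] ℂ) {φ : E₂ → ℝ} (hφ : ContDiff ℝ ∞ φ)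
    (hφc : HasCompactSupport φ) :
    ∫ z in (analyticChain (prodPeriodL2 Φ₁ Φ₂) hZ).carrier ∩
        {z : WithLp 2 (E₁ × E₂) | (ofLp z).1 ∈ periodBox Φ₁ 0},
      wedgeOne ((fderiv ℝ φ (ofLp z).2).comp ((ContinuousLinearMap.snd ℝ E₁ E₂).comp
          (WithLp.prodContinuousLinearEquiv 2 ℝ E₁ E₂ : WithLp 2 (E₁ × E₂) →L[ℝ] E₁ × E₂))) Θ
        ((analyticChain (prodPeriodL2 Φ₁ Φ₂) hZ).orientationFrame z)
      ∂(μHE[2 * (m + 1)] : Measure (WithLp 2 (E₁ × E₂))) = 0 := by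
  classical
  set K : Finset (ι₁ ⊕ ι₂) := (Finset.univ : Finset ι₁).map ⟨Sum.inl, Sum.inl_injective⟩ with hK
  set T := analyticChain (prodPeriodL2 Φ₁ Φ₂) hZ with hT
  set C := T.carrier with hC
  set S : Set (WithLp 2 (E₁ × E₂)) := {z | (ofLp z).1 ∈ periodBox Φ₁ 0} with hS
  set s₂ : WithLp 2 (E₁ × E₂) →L[ℝ] E₂ := (ContinuousLinearMap.snd ℝ E₁ E₂).comp
    (WithLp.prodContinuousLinearEquiv 2 ℝ E₁ E₂ : WithLp 2 (E₁ × E₂) →L[ℝ] E₁ × E₂) with hs₂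
  have hs₂apply : ∀ z, s₂ z = (ofLp z).2 := fun _ ↦ rfl
  have hCm : MeasurableSet C := T.measurableSet_carrier
  have hSm : MeasurableSet S := measurableSet_slabFst (E₂ := E₂) Φ₁
  -- periodicity of the chain `[π⁻¹Z]`
  have hper := translateTop_preimage_liftSet (prodPeriodL2 Φ₁ Φ₂) Z
  have hcar : ∀ (n : ι₁ ⊕ ι₂ → ℤ) (x : WithLp 2 (E₁ × E₂)),
      latticeVec (prodPeriodL2 Φ₁ Φ₂) n + x ∈ T.carrier ↔ x ∈ T.carrier :=
    HolomorphicChain.carrier_ofSet_periodic (prodPeriodL2 Φ₁ Φ₂) (hasPureDim_liftSet (prodPeriodL2 Φ₁ Φ₂) hZ) hper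
  have hdens : ∀ (n : ι₁ ⊕ ι₂ → ℤ), ∀ x ∈ T.carrier,
      T.density (latticeVec (prodPeriodL2 Φ₁ Φ₂) n + x) = T.density x := by
    intro n x hx
    change (HolomorphicChain.ofSet _ (hasPureDim_liftSet (prodPeriodL2 Φ₁ Φ₂) hZ)).density _ =
      (HolomorphicChain.ofSet _ (hasPureDim_liftSet (prodPeriodL2 Φ₁ Φ₂) hZ)).density x
    rw [HolomorphicChain.density_ofSet_of_mem_carrier _ hx,
      HolomorphicChain.density_ofSet_of_mem_carrier _ ((hcar n x).2 hx)]
  -- the weight `φ ∘ pr₂`: smooth, with derivative `Dφ(z₂) ∘ pr₂`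
  have hg : ContDiff ℝ ∞ fun z : WithLp 2 (E₁ × E₂) ↦ φ (ofLp z).2 := by
    have : (fun z : WithLp 2 (E₁ × E₂) ↦ φ (ofLp z).2) = φ ∘ s₂ := by funext z; rfl
    rw [this]
    exact hφ.comp s₂.contDiff
  have hDg : ∀ z : WithLp 2 (E₁ × E₂), fderiv ℝ (fun z : WithLp 2 (E₁ × E₂) ↦ φ (ofLp z).2) z =
      (fderiv ℝ φ (ofLp z).2).comp s₂ := by
    intro z
    have : (fun z : WithLp 2 (E₁ × E₂) ↦ φ (ofLp z).2) = φ ∘ s₂ := by funext z; rfl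
    rw [this]
    have hd : DifferentiableAt ℝ φ (s₂ z) := (hφ.differentiable (by simp)).differentiableAt
    rw [fderiv_comp z hd s₂.differentiableAt, s₂.fderiv]
    rfl
  -- a bound for the support of `φ` in the coordinates `ι₂`
  obtain ⟨R₀, hR₀⟩ := hφc.isCompact.isBounded.subset_closedBall 0
  set R : ℝ := ‖(Φ₂.symm : E₂ →L[ℝ] ι₂ → ℝ)‖ * R₀ with hR
  -- Stokes for a REAL constant form
  have hreal : ∀ Θr : WithLp 2 (E₁ × E₂) [⋀^Fin (2 * m + 1)]→L[ℝ] ℝ,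
      ∫ z in C ∩ S, wedgeOne ((fderiv ℝ φ (ofLp z).2).comp s₂) Θr (T.orientationFrame z)
        ∂(μHE[2 * (m + 1)] : Measure (WithLp 2 (E₁ × E₂))) = 0 := by
    intro Θr
    set Ψ : WithLp 2 (E₁ × E₂) → WithLp 2 (E₁ × E₂) [⋀^Fin (2 * m + 1)]→L[ℝ] ℝ :=
      fun z ↦ φ (ofLp z).2 • Θr with hΨ
    have hΨs : ContDiff ℝ ∞ Ψ := hg.smul contDiff_const
    have hΨper : ∀ (n : K → ℤ) (x : WithLp 2 (E₁ × E₂)), Ψ (latticeVecOn (prodPeriodL2 Φ₁ Φ₂) K n + x) = Ψ x := by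
      intro n x
      simp only [hΨ]
      rw [WithLp.ofLp_add, Prod.snd_add, snd_latticeVecOn_map_inl Φ₁ Φ₂ n, zero_add]
    have hΨR : ∀ x, Ψ x ≠ 0 → ∀ i, i ∉ K → |(prodPeriodL2 Φ₁ Φ₂).symm x i| ≤ R := by
      intro x hx i hi
      have hφx : φ (ofLp x).2 ≠ 0 := by
        intro h0
        exact hx (by simp only [hΨ, h0, zero_smul])
      have hxR : ‖(ofLp x).2‖ ≤ R₀ :=
        mem_closedBall_zero_iff.1 (hR₀ (subset_tsupport _ (mem_support.2 hφx)))
      rcases i with i | j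
      · exact (hi (by simp [hK])).elim
      · have h1 : (prodPeriodL2 Φ₁ Φ₂).symm x (Sum.inr j) = Φ₂.symm (ofLp x).2 j := by
          rw [prodPeriodL2_symm_apply]
          exact congrFun (prodPeriod_symm_inr Φ₁ Φ₂ (ofLp x)) j
        rw [h1]
        calc |Φ₂.symm (ofLp x).2 j| = ‖Φ₂.symm (ofLp x).2 j‖ := (Real.norm_eq_abs _).symm
          _ ≤ ‖Φ₂.symm (ofLp x).2‖ := norm_le_pi_norm _ j
          _ ≤ ‖(Φ₂.symm : E₂ →L[ℝ] ι₂ → ℝ)‖ * ‖(ofLp x).2‖ :=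
              (Φ₂.symm : E₂ →L[ℝ] ι₂ → ℝ).le_opNorm _
          _ ≤ ‖(Φ₂.symm : E₂ →L[ℝ] ι₂ → ℝ)‖ * R₀ := by gcongr
    have hStokes := T.setIntegral_slab_density_mul_extDeriv_apply_eq_zero (prodPeriodL2 Φ₁ Φ₂) K hcar hdens
      hΨs hΨper hΨR
    -- `dΨ = D(φ∘pr₂) ∧ Θr`
    have hdΨ : ∀ z, extDeriv Ψ z = wedgeOne ((fderiv ℝ φ (ofLp z).2).comp s₂) Θr := by
      intro z
      rw [hΨ, extDeriv_smul_apply_eq hg contDiff_const z, hDg z]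
      have h0 : extDeriv (fun _ : WithLp 2 (E₁ × E₂) ↦ Θr) z = 0 := by
        rw [extDeriv, fderiv_const_apply]
        exact (ContinuousAlternatingMap.alternatizeUncurryFinCLM ℝ (WithLp 2 (E₁ × E₂)) ℝ).map_zero
      rw [h0, smul_zero, add_zero]
      rfl
    rw [slab_map_inl_eq Φ₁ Φ₂] at hStokes
    rw [← hStokes, Measure.restrict_restrict hSm, inter_comm S C]
    refine setIntegral_congr_fun (hCm.inter hSm) fun z hz ↦ ?_
    rw [hdΨ z, show T.density z = 1 from HolomorphicChain.density_ofSet_of_mem_carrier _ hz.1]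
    simp
  -- the complex form: real and imaginary parts
  set f : WithLp 2 (E₁ × E₂) → ℂ := fun z ↦
    wedgeOne ((fderiv ℝ φ (ofLp z).2).comp s₂) Θ (T.orientationFrame z) with hf
  change ∫ z in C ∩ S, f z ∂(μHE[2 * (m + 1)] : Measure (WithLp 2 (E₁ × E₂))) = 0
  by_cases hfi : Integrable f ((μHE[2 * (m + 1)] : Measure (WithLp 2 (E₁ × E₂))).restrict (C ∩ S))
  · apply Complex.ext
    · rw [Complex.zero_re]
      change Complex.reCLM (∫ z in C ∩ S, f z ∂(μHE[2 * (m + 1)] : Measure (WithLp 2 (E₁ × E₂)))) = 0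
      rw [← ContinuousLinearMap.integral_comp_comm _ hfi, ← hreal (Complex.reCLM.compContinuousAlternatingMap Θ)]
      refine integral_congr_ae (ae_of_all _ fun z ↦ ?_)
      exact apply_wedgeOne_eq_wedgeOne_compContinuousAlternatingMap Complex.reCLM _ Θ _
    · rw [Complex.zero_im]
      change Complex.imCLM (∫ z in C ∩ S, f z ∂(μHE[2 * (m + 1)] : Measure (WithLp 2 (E₁ × E₂)))) = 0
      rw [← ContinuousLinearMap.integral_comp_comm _ hfi, ← hreal (Complex.imCLM.compContinuousAlternatingMap Θ)]
      refine integral_congr_ae (ae_of_all _ fun z ↦ ?_)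
      exact apply_wedgeOne_eq_wedgeOne_compContinuousAlternatingMap Complex.imCLM _ Θ _
  · exact integral_undef hfi

open Classical in
/-- **THE FIBRE PERIOD HAS ZERO DISTRIBUTIONAL GRADIENT**: for `Z ⊆ X₁ × X₂` closed analytic of pure
dimension `m + 1 = q + dim E₂` (`0 < q`), an invariant `2q`-form `γ` of `X₁`, a smooth compactly
supported `φ : E₂ → ℝ` and `v ∈ E₂`,
`∫_{E₂} (∂_v φ)(t) · F_γ(t) d𝓗^{2 dim E₂}(t) = 0`, `F_γ(t) = ∫_{Z_t} γ` (a.e. defined fibre period).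
Proof: Stokes over the slab for `Θ = pr₁^*γ ∧ pr₂^*(v ⌟ vol₂)` (§3), the identity
`D(φ∘pr₂) ∧ Θ = (∂_vφ ∘ pr₂) · pr₁^*γ ∧ pr₂^*vol₂` (§2) and the weighted fibre formula with weight
`∂_v φ` (file 1): `vol₂(e₂, ie₂, …) ∫ (∂_vφ) F_γ = 0`, `vol₂(e₂, ie₂, …) ≠ 0`.
[cite: Federer1969, 4.3.1 (slices of a closed current are closed) and 3.2.22] [cite: King1971, §3]
[cite: Fulton1998, §10.2 Prop. 10.2] -/
theorem integral_fderiv_mul_fibreSlicePeriod_eq_zero {m q k : ℕ} (hq : 0 < q)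
    (hm : m + 1 = q + finrank ℂ E₂) (hk : k + 1 = 2 * finrank ℂ E₂)
    {Z : Set (ComplexTorus (prodPeriodL2 Φ₁ Φ₂))} (hZ : HasPureDim 𝓘(ℂ, WithLp 2 (E₁ × E₂)) Z (m + 1))
    (γ : E₁ [⋀^Fin (2 * q)]→L[ℝ] ℂ) (ν : E₂ [⋀^Fin (k + 1)]→L[ℝ] ℂ)
    (e₂ : OrthonormalBasis (Fin (finrank ℂ E₂)) ℂ E₂)
    (hν : ν.domDomCongr (finCongr hk) (complexFrame ⇑e₂) ≠ 0)
    {φ : E₂ → ℝ} (hφ : ContDiff ℝ ∞ φ) (hφc : HasCompactSupport φ) (v : E₂) :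
    ∫ t, ((fderiv ℝ φ t v : ℝ) : ℂ) *
        (if h : HasPureDim 𝓘(ℂ, E₁)
            {x : ComplexTorus Φ₁ | (prodHomeomorphL2 Φ₁ Φ₂).symm (x, cover Φ₂ t) ∈ Z} q
          then analyticCyclePeriod Φ₁ h γ else 0) ∂(μHE[2 * finrank ℂ E₂] : Measure E₂) = 0 := by
  haveI : FiniteDimensional ℝ E₂ := FiniteDimensional.complexToReal E₂
  set ν' : E₂ [⋀^Fin (2 * finrank ℂ E₂)]→L[ℝ] ℂ := ν.domDomCongr (finCongr hk) with hν'
  set P := (WithLp.prodContinuousLinearEquiv 2 ℝ E₁ E₂ : WithLp 2 (E₁ × E₂) →L[ℝ] E₁ × E₂) with hP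
  set s₂ : WithLp 2 (E₁ × E₂) →L[ℝ] E₂ := (ContinuousLinearMap.snd ℝ E₁ E₂).comp P with hs₂
  -- the weight `∂_v φ`: continuous, bounded, compactly supported
  set g : E₂ → ℂ := fun t ↦ ((fderiv ℝ φ t v : ℝ) : ℂ) with hg
  have hgc : Continuous fun t ↦ fderiv ℝ φ t v := (hφ.continuous_fderiv (by simp)).clm_apply continuous_const
  have hgm : Measurable g := (Complex.continuous_ofReal.comp hgc).measurable
  have hgsupp : HasCompactSupport fun t ↦ fderiv ℝ φ t v := hφc.fderiv_apply (𝕜 := ℝ) v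
  obtain ⟨M, hM⟩ := (hgc.norm).bddAbove_range_of_hasCompactSupport hgsupp.norm
  have hgM : ∀ t, ‖g t‖ ≤ M := fun t ↦ by
    rw [hg, Complex.norm_real]
    exact hM (mem_range_self t)
  obtain ⟨R, hR⟩ := hgsupp.isCompact.isBounded.subset_closedBall 0
  have hgR : ∀ t, g t ≠ 0 → ‖t‖ ≤ R := fun t ht ↦ by
    have ht' : fderiv ℝ φ t v ≠ 0 := fun h ↦ ht (by simp only [hg, h, Complex.ofReal_zero])
    exact mem_closedBall_zero_iff.1 (hR (subset_tsupport _ (mem_support.2 ht')))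
  -- the weighted fibre formula with weight `∂_v φ`, transported to dimension `m + 1`
  have hfib : ∀ {d : ℕ} (hZd : HasPureDim 𝓘(ℂ, WithLp 2 (E₁ × E₂)) Z d) (hd : d = q + finrank ℂ E₂)
      (h2 : 2 * q + 2 * finrank ℂ E₂ = 2 * d),
      ∫ z in (analyticChain (prodPeriodL2 Φ₁ Φ₂) hZd).carrier ∩
          {z : WithLp 2 (E₁ × E₂) | (ofLp z).1 ∈ periodBox Φ₁ 0},
          g (ofLp z).2 * ((((γ.compContinuousLinearMap (ContinuousLinearMap.fst ℝ E₁ E₂)).wedge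
              (ν'.compContinuousLinearMap (ContinuousLinearMap.snd ℝ E₁ E₂))).domDomCongr
            (finCongr h2)).compContinuousLinearMap P)
            ((analyticChain (prodPeriodL2 Φ₁ Φ₂) hZd).orientationFrame z)
          ∂(μHE[2 * d] : Measure (WithLp 2 (E₁ × E₂))) =
        ν' (complexFrame ⇑e₂) * ∫ t, g t *
          (if h : HasPureDim 𝓘(ℂ, E₁)
              {x : ComplexTorus Φ₁ | (prodHomeomorphL2 Φ₁ Φ₂).symm (x, cover Φ₂ t) ∈ Z} q
            then analyticCyclePeriod Φ₁ h γ else 0) ∂(μHE[2 * finrank ℂ E₂] : Measure E₂) := by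
    intro d hZd hd h2
    subst hd
    exact setIntegral_weight_cross_eq_integral_fibreSlice Φ₁ Φ₂ hq hZd γ ν' h2 e₂ hgm hgM hgR
  have h2 : 2 * q + 2 * finrank ℂ E₂ = 2 * (m + 1) := by omega
  have key := hfib hZ hm h2
  -- Stokes with `Θ = pr₁^*γ ∧ pr₂^*(v ⌟ ν)` and the algebra of §2
  set Θ : WithLp 2 (E₁ × E₂) [⋀^Fin (2 * m + 1)]→L[ℝ] ℂ :=
    (((γ.compContinuousLinearMap (ContinuousLinearMap.fst ℝ E₁ E₂)).wedge
        ((ν.curryLeft v).compContinuousLinearMap (ContinuousLinearMap.snd ℝ E₁ E₂))).compContinuousLinearMap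
      P).domDomCongr (finCongr (by omega : 2 * q + k = 2 * m + 1)) with hΘ
  have hStokes := setIntegral_slab_wedgeOne_fderiv_eq_zero Φ₁ Φ₂ hZ Θ hφ hφc
  have hνtop : ∀ θ : E₂ →L[ℝ] ℝ, wedgeOne θ ν = 0 := fun θ ↦
    ContinuousAlternatingMap.eq_zero_of_finrank_lt _ (by rw [finrank_real_of_complex]; omega)
  have halg := wedgeOne_cross_curryLeft γ ν hνtop
  -- the two integrands agree pointwise
  have hpt : ∀ z : WithLp 2 (E₁ × E₂), ∀ w : Fin (2 * (m + 1)) → WithLp 2 (E₁ × E₂),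
      wedgeOne ((fderiv ℝ φ (ofLp z).2).comp s₂) Θ w =
        g (ofLp z).2 * ((((γ.compContinuousLinearMap (ContinuousLinearMap.fst ℝ E₁ E₂)).wedge
            (ν'.compContinuousLinearMap (ContinuousLinearMap.snd ℝ E₁ E₂))).domDomCongr
          (finCongr h2)).compContinuousLinearMap P) w := by
    intro z w
    have hq' : 2 * q + k = 2 * m + 1 := by omega
    have hY : 2 * q + (k + 1) = 2 * (m + 1) := by omega
    -- left: remove the cast on `Θ` and apply the algebra of §2
    have e1 : wedgeOne ((fderiv ℝ φ (ofLp z).2).comp s₂) Θ =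
        (((fderiv ℝ φ (ofLp z).2 v : ℝ) • (((γ.compContinuousLinearMap (ContinuousLinearMap.fst ℝ E₁ E₂)).wedge
            (ν.compContinuousLinearMap (ContinuousLinearMap.snd ℝ E₁ E₂))).compContinuousLinearMap P))).domDomCongr
          (finCongr (congrArg (· + 1) hq')) := by
      rw [hΘ, wedgeOne_domDomCongr_finCongr, halg (fderiv ℝ φ (ofLp z).2) v]
    -- right: collect the casts
    have e2 : (((γ.compContinuousLinearMap (ContinuousLinearMap.fst ℝ E₁ E₂)).wedge
          (ν'.compContinuousLinearMap (ContinuousLinearMap.snd ℝ E₁ E₂))).domDomCongr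
        (finCongr h2)).compContinuousLinearMap P =
        (((γ.compContinuousLinearMap (ContinuousLinearMap.fst ℝ E₁ E₂)).wedge
            (ν.compContinuousLinearMap (ContinuousLinearMap.snd ℝ E₁ E₂))).compContinuousLinearMap P).domDomCongr
          (finCongr hY) := by
      rw [hν', show ((ν.domDomCongr (finCongr hk)).compContinuousLinearMap (ContinuousLinearMap.snd ℝ E₁ E₂)) =
          (ν.compContinuousLinearMap (ContinuousLinearMap.snd ℝ E₁ E₂)).domDomCongr (finCongr hk) from rfl,
        wedge_domDomCongr_finCongr, domDomCongr_finCongr_trans, domDomCongr_finCongr_compContinuousLinearMap]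
    rw [e1, e2]
    simp only [ContinuousAlternatingMap.domDomCongr_apply, ContinuousAlternatingMap.smul_apply, Complex.real_smul, hg]
  have hint_eq : ∫ z in (analyticChain (prodPeriodL2 Φ₁ Φ₂) hZ).carrier ∩
        {z : WithLp 2 (E₁ × E₂) | (ofLp z).1 ∈ periodBox Φ₁ 0},
        wedgeOne ((fderiv ℝ φ (ofLp z).2).comp s₂) Θ ((analyticChain (prodPeriodL2 Φ₁ Φ₂) hZ).orientationFrame z)
        ∂(μHE[2 * (m + 1)] : Measure (WithLp 2 (E₁ × E₂))) =
      ν' (complexFrame ⇑e₂) * ∫ t, g t *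
          (if h : HasPureDim 𝓘(ℂ, E₁)
              {x : ComplexTorus Φ₁ | (prodHomeomorphL2 Φ₁ Φ₂).symm (x, cover Φ₂ t) ∈ Z} q
            then analyticCyclePeriod Φ₁ h γ else 0) ∂(μHE[2 * finrank ℂ E₂] : Measure E₂) := by
    rw [← key]
    exact integral_congr_ae (ae_of_all _ fun z ↦ hpt z _)
  rw [hStokes] at hint_eq
  exact (mul_eq_zero.1 hint_eq.symm).resolve_left hν

end Stokes

/-! ### §4 The generic fibre class is constant, and equals the restriction `i₀^*[Z]` -/

section Constant

variable {ι₁ ι₂ : Type*} [Fintype ι₁] [Fintype ι₂] [DecidableEq ι₁] [DecidableEq ι₂]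
  {E₁ : Type u} [NormedAddCommGroup E₁] [InnerProductSpace ℂ E₁] [FiniteDimensional ℂ E₁]
  [MeasurableSpace E₁] [BorelSpace E₁]
  {E₂ : Type u} [NormedAddCommGroup E₂] [InnerProductSpace ℂ E₂] [FiniteDimensional ℂ E₂]
  [MeasurableSpace E₂] [BorelSpace E₂]
  (Φ₁ : (ι₁ → ℝ) ≃L[ℝ] E₁) (Φ₂ : (ι₂ → ℝ) ≃L[ℝ] E₂)

open Classical in
/-- **Normalisation of the fibre measure: `ν(e₂, ie₂, …) · 𝓗^{2 dim E₂}(Φ₂[0,1)^ι₂) = ∫_{X₂} ν`** for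
every invariant top form `ν` of `X₂` and every unitary basis `e₂` (the fibre formula for `Z = X₂ × X₂`
over the torus `X₂ × X₂`, whose slices are all of `X₂`, against `vol ⊠ ν`: `∫_{X₂ × X₂} pr₁^*vol ∧ pr₂^*ν
= ∫_{X₂} vol · ∫_{X₂} ν = ∫_{X₂} ν`). In particular `vol(e₂, ie₂, …) 𝓗(Φ₂[0,1)^ι₂) = 1` for the oriented
volume form. [cite: Lange2023AbelianVarietiesComplex, §6.2.4 (6.10) and §1.1.1] [cite: Federer1969, 3.2.22] -/
theorem apply_complexFrame_mul_measure_periodBox (hE₂ : 0 < finrank ℂ E₂)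
    (e : Fin (2 * finrank ℂ E₂) ≃ ι₂) (ν : E₂ [⋀^Fin (2 * finrank ℂ E₂)]→L[ℝ] ℂ)
    (e₂ : OrthonormalBasis (Fin (finrank ℂ E₂)) ℂ E₂) :
    ν (complexFrame ⇑e₂) * (((μHE[2 * finrank ℂ E₂] : Measure E₂) (periodBox Φ₂ 0)).toReal : ℂ) =
      torusIntegral Φ₂ e ν := by
  letI : InnerProductSpace ℝ E₂ := InnerProductSpace.complexToReal
  haveI : FiniteDimensional ℝ E₂ := FiniteDimensional.complexToReal E₂
  have hV22 : finrank ℝ E₂ = 2 * finrank ℂ E₂ := by rw [finrank_real_of_complex]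
  haveI : (μHE[2 * (finrank ℂ E₂)] : Measure E₂).IsAddHaarMeasure := by
    rw [← hV22, InnerProductSpace.euclideanHausdorffMeasure_eq_volume]; infer_instance
  -- the fibre formula for `Z = X₂ × X₂`, `γ = vol`
  set U : Set (ComplexTorus (prodPeriodL2 Φ₂ Φ₂)) :=
    ⇑(prodHomeomorphL2 Φ₂ Φ₂) ⁻¹' ((univ : Set (ComplexTorus Φ₂)) ×ˢ (univ : Set (ComplexTorus Φ₂))) with hU
  have hUp : HasPureDim 𝓘(ℂ, WithLp 2 (E₂ × E₂)) U (finrank ℂ E₂ + finrank ℂ E₂) :=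
    hasPureDim_preimage_prodHomeomorphL2_prod_univ Φ₂ Φ₂ (hasPureDim_univ (I := 𝓘(ℂ, E₂)) (M := ComplexTorus Φ₂))
  have h2 : 2 * finrank ℂ E₂ + 2 * finrank ℂ E₂ = 2 * (finrank ℂ E₂ + finrank ℂ E₂) :=
    (mul_add 2 (finrank ℂ E₂) (finrank ℂ E₂)).symm
  have hfib := analyticCyclePeriod_cross_eq_integral_fibreSlice Φ₂ Φ₂ hE₂ hUp (volumeForm Φ₂ e) ν h2 e₂
  -- the left side is `∫_{X₂} vol · ∫_{X₂} ν = ∫_{X₂} ν`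
  have hcross := analyticCyclePeriod_prodL2_prod_univ_cross Φ₂ Φ₂
    (hasPureDim_univ (I := 𝓘(ℂ, E₂)) (M := ComplexTorus Φ₂)) e (volumeForm Φ₂ e) ν
  rw [analyticCyclePeriod_univ_volumeForm Φ₂ e, one_mul] at hcross
  rw [hcross] at hfib
  -- the right side: every slice is `X₂`, with period `∫_{X₂} vol = 1`
  have hslice : ∀ t : E₂, {x : ComplexTorus Φ₂ | (prodHomeomorphL2 Φ₂ Φ₂).symm (x, cover Φ₂ t) ∈ U} = univ :=
    fun t ↦ by
    ext x
    simp [hU]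
  have hF : ∀ t : E₂, (if h : HasPureDim 𝓘(ℂ, E₂)
      {x : ComplexTorus Φ₂ | (prodHomeomorphL2 Φ₂ Φ₂).symm (x, cover Φ₂ t) ∈ U} (finrank ℂ E₂)
      then analyticCyclePeriod Φ₂ h (volumeForm Φ₂ e) else 0) = 1 := by
    intro t
    have hpure : HasPureDim 𝓘(ℂ, E₂) {x : ComplexTorus Φ₂ | (prodHomeomorphL2 Φ₂ Φ₂).symm (x, cover Φ₂ t) ∈ U}
        (finrank ℂ E₂) := by
      rw [hslice t]; exact hasPureDim_univ
    rw [dif_pos hpure, analyticCyclePeriod_congr_set Φ₂ (hslice t) hpure hasPureDim_univ,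
      analyticCyclePeriod_univ_volumeForm Φ₂ e]
  simp only [hF, setIntegral_const, mul_one, Complex.real_smul] at hfib
  rw [hfib, measureReal_def]

open Classical in
/-- **THE FIBRE PERIOD IS a.e. CONSTANT**: for `Z ⊆ X₁ × X₂` closed analytic of pure dimension
`q + dim X₂`, `0 < q`, and an invariant `2q`-form `γ` of `X₁`, the function `t ↦ ∫_{Z_t} γ` (set to `0`
where the slice is not of pure dimension `q`) is a.e. equal to a constant on `E₂`: it is locally
integrable (file 1) with zero distributional gradient (§3), and §1 applies.
[cite: Fulton1998, §10.2 Prop. 10.2 (conservation of number)] [cite: Federer1969, 4.1.7 and 4.3.1]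
[cite: King1971, §3] -/
theorem ae_eq_const_fibreSlicePeriod {q : ℕ} (hq : 0 < q)
    {Z : Set (ComplexTorus (prodPeriodL2 Φ₁ Φ₂))}
    (hZ : HasPureDim 𝓘(ℂ, WithLp 2 (E₁ × E₂)) Z (q + finrank ℂ E₂)) (γ : E₁ [⋀^Fin (2 * q)]→L[ℝ] ℂ) :
    ∃ a : ℂ, (fun t ↦ (if h : HasPureDim 𝓘(ℂ, E₁)
        {x : ComplexTorus Φ₁ | (prodHomeomorphL2 Φ₁ Φ₂).symm (x, cover Φ₂ t) ∈ Z} q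
      then analyticCyclePeriod Φ₁ h γ else 0)) =ᵐ[(μHE[2 * finrank ℂ E₂] : Measure E₂)] fun _ ↦ a := by
  haveI : FiniteDimensional ℝ E₂ := FiniteDimensional.complexToReal E₂
  letI : InnerProductSpace ℝ E₂ := InnerProductSpace.complexToReal
  have hV22 : finrank ℝ E₂ = 2 * finrank ℂ E₂ := by rw [finrank_real_of_complex]
  haveI : (μHE[2 * (finrank ℂ E₂)] : Measure E₂).IsAddHaarMeasure := by
    rw [← hV22, InnerProductSpace.euclideanHausdorffMeasure_eq_volume]; infer_instance
  -- degenerate case `E₂ = 0`: a single point `t = 0`, everything is a.e. constant trivially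
  rcases Nat.eq_zero_or_pos (finrank ℂ E₂) with h0 | hE₂
  · haveI : Subsingleton E₂ := by
      have h : finrank ℝ E₂ = 0 := by rw [hV22, h0, mul_zero]
      exact (finrank_zero_iff (R := ℝ)).1 h
    refine ⟨(if h : HasPureDim 𝓘(ℂ, E₁)
        {x : ComplexTorus Φ₁ | (prodHomeomorphL2 Φ₁ Φ₂).symm (x, cover Φ₂ 0) ∈ Z} q
      then analyticCyclePeriod Φ₁ h γ else 0), ae_of_all _ fun t ↦ ?_⟩
    rw [Subsingleton.elim t 0]
  -- the volume form of `X₂`, as a form of degree `k + 1`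
  obtain ⟨k, hk⟩ : ∃ k, k + 1 = 2 * finrank ℂ E₂ := ⟨2 * finrank ℂ E₂ - 1, by omega⟩
  obtain ⟨m, hm⟩ : ∃ m, m + 1 = q + finrank ℂ E₂ := ⟨q + finrank ℂ E₂ - 1, by omega⟩
  have hcard : Fintype.card ι₂ = 2 * finrank ℂ E₂ := by
    rw [← Module.finrank_fintype_fun_eq_card (R := ℝ), Φ₂.toLinearEquiv.finrank_eq, finrank_real_of_complex]
  set e₂' : Fin (2 * finrank ℂ E₂) ≃ ι₂ := (Fintype.equivFinOfCardEq hcard).symm with he₂'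
  set eK : OrthonormalBasis (Fin (finrank ℂ E₂)) ℂ E₂ := stdOrthonormalBasis ℂ E₂ with heK
  have hvol : volumeForm Φ₂ e₂' (complexFrame ⇑eK) ≠ 0 := by
    intro h
    have h1 := apply_complexFrame_mul_measure_periodBox Φ₂ hE₂ e₂' (volumeForm Φ₂ e₂') eK
    rw [h, zero_mul, torusIntegral_volumeForm] at h1
    exact zero_ne_one h1
  set ν : E₂ [⋀^Fin (k + 1)]→L[ℝ] ℂ := (volumeForm Φ₂ e₂').domDomCongr (finCongr hk.symm) with hν
  have hνvol : ν.domDomCongr (finCongr hk) = volumeForm Φ₂ e₂' := by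
    rw [hν, domDomCongr_finCongr_trans]
    exact domDomCongr_finCongr_self _ _
  have hν0 : ν.domDomCongr (finCongr hk) (complexFrame ⇑eK) ≠ 0 := by rwa [hνvol]
  -- transport `hZ` to dimension `m + 1`
  have hZ' : HasPureDim 𝓘(ℂ, WithLp 2 (E₁ × E₂)) Z (m + 1) := hm ▸ hZ
  refine ae_eq_const_of_forall_integral_fderiv_mul_eq_zero_complex (μHE[2 * finrank ℂ E₂] : Measure E₂)
    (fun R ↦ integrableOn_fibreSlicePeriod_closedBall Φ₁ Φ₂ hq hZ γ hvol R) fun g hg hgc v ↦ ?_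
  have h := integral_fderiv_mul_fibreSlicePeriod_eq_zero Φ₁ Φ₂ hq hm hk hZ' γ ν eK hν0 hg hgc v
  exact h

open Classical in
/-- The Poincaré pairing of `γ` with the class of a subset `W ⊆ X` (`setCycleClass`: the analytic cycle
class when `W` has pure dimension `d`, else `0`) is the period `∫_W γ` (resp. `0`).
[cite: VoisinHodgeI2002, §11.1.2 Cor. 11.15] -/
theorem poincarePairing_setCycleClass_eq_dite {ι : Type*} [Fintype ι] [DecidableEq ι] {E : Type u}
    [NormedAddCommGroup E] [InnerProductSpace ℂ E] [FiniteDimensional ℂ E] [MeasurableSpace E] [BorelSpace E]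
    (Φ : (ι → ℝ) ≃L[ℝ] E) {n d k : ℕ} (e : Fin n ≃ ι) (h : 2 * d + k = n) (W : Set (ComplexTorus Φ))
    (γ : E [⋀^Fin (2 * d)]→L[ℝ] ℂ) :
    poincarePairing Φ e h γ (setCycleClass Φ e h W) =
      (if hW : HasPureDim 𝓘(ℂ, E) W d then analyticCyclePeriod Φ hW γ else 0) := by
  by_cases hW : HasPureDim 𝓘(ℂ, E) W d
  · rw [setCycleClass_of_hasPureDim Φ e h hW, poincarePairing_analyticCycleClass, dif_pos hW]
  · rw [setCycleClass, dif_neg hW, dif_neg hW, map_zero]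

/-- Re-reading the degree of the left argument of the Poincaré pairing. [folklore] -/
private theorem poincarePairing_domDomCongr_left' {ι : Type*} [Fintype ι] [DecidableEq ι] {E : Type*}
    [NormedAddCommGroup E] [NormedSpace ℂ E] (Φ : (ι → ℝ) ≃L[ℝ] E) {n k k' l : ℕ}
    (e : Fin n ≃ ι) (hkk : k = k') (h : k + l = n) (h' : k' + l = n) (γ : E [⋀^Fin k]→L[ℝ] ℂ)
    (δ : E [⋀^Fin l]→L[ℝ] ℂ) :
    poincarePairing Φ e h' (γ.domDomCongr (finCongr hkk)) δ = poincarePairing Φ e h γ δ := by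
  subst hkk; rfl

open Classical in
/-- **THE CLASS OF THE GENERIC FIBRE IS CONSTANT.** For `Z ⊆ X₁ × X₂` closed analytic of pure dimension
`q + dim X₂` (`0 < q`, codimension `p` in `X₁` for the slices: `2q + 2p = rk Λ₁`) there is ONE class
`R ∈ H^{2p}(X₁, ℂ)` with `cl_{e₁}(Z_t) = R` for a.e. `t ∈ E₂`, where `cl_{e₁}(Z_t) = setCycleClass Φ₁ e₁ _ Z_t`
is the analytic cycle class of the slice `Z_t = {x̄ | (x̄, π₂ t) ∈ Z}` when it has pure dimension `q` and
`0` otherwise (the a.e. dichotomy of `ae_hasPureDim_fibreSlice`): Fulton's "the cycle classes `α_t` all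
have the same degree" for every test class `γ`, assembled over a basis of `H^{2q}(X₁, ℂ)` by Poincaré
duality. [cite: Fulton1998, §10.1 Cor. 10.1 and §10.2 Prop. 10.2] [cite: Federer1969, 4.3.1]
[cite: King1971, §3] -/
theorem exists_ae_setCycleClass_fibreSlice_eq {n₁ q p : ℕ} (e₁ : Fin n₁ ≃ ι₁) (hq : 0 < q)
    (h₁ : 2 * q + 2 * p = n₁) {Z : Set (ComplexTorus (prodPeriodL2 Φ₁ Φ₂))}
    (hZ : HasPureDim 𝓘(ℂ, WithLp 2 (E₁ × E₂)) Z (q + finrank ℂ E₂)) :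
    ∃ R : E₁ [⋀^Fin (2 * p)]→L[ℝ] ℂ, ∀ᵐ t ∂(μHE[2 * finrank ℂ E₂] : Measure E₂),
      setCycleClass Φ₁ e₁ h₁
        {x : ComplexTorus Φ₁ | (prodHomeomorphL2 Φ₁ Φ₂).symm (x, cover Φ₂ t) ∈ Z} = R := by
  haveI : FiniteDimensional ℝ E₂ := FiniteDimensional.complexToReal E₂
  letI : InnerProductSpace ℝ E₂ := InnerProductSpace.complexToReal
  have hV22 : finrank ℝ E₂ = 2 * finrank ℂ E₂ := by rw [finrank_real_of_complex]
  haveI : (μHE[2 * (finrank ℂ E₂)] : Measure E₂).IsAddHaarMeasure := by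
    rw [← hV22, InnerProductSpace.euclideanHausdorffMeasure_eq_volume]; infer_instance
  haveI := finiteDimensional_alt_complex Φ₁ (2 * q)
  set b := Module.finBasis ℂ (E₁ [⋀^Fin (2 * q)]→L[ℝ] ℂ) with hb
  set Zt : E₂ → Set (ComplexTorus Φ₁) := fun t ↦
    {x : ComplexTorus Φ₁ | (prodHomeomorphL2 Φ₁ Φ₂).symm (x, cover Φ₂ t) ∈ Z} with hZt
  -- for each basis class, the fibre period is a.e. constant
  have hj : ∀ j, ∃ a : ℂ, (fun t ↦ poincarePairing Φ₁ e₁ h₁ (b j) (setCycleClass Φ₁ e₁ h₁ (Zt t)))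
      =ᵐ[(μHE[2 * finrank ℂ E₂] : Measure E₂)] fun _ ↦ a := by
    intro j
    obtain ⟨a, ha⟩ := ae_eq_const_fibreSlicePeriod Φ₁ Φ₂ hq hZ (b j)
    refine ⟨a, ?_⟩
    filter_upwards [ha] with t ht
    rw [poincarePairing_setCycleClass_eq_dite]
    exact ht
  choose a ha using hj
  have hall : ∀ᵐ t ∂(μHE[2 * finrank ℂ E₂] : Measure E₂),
      ∀ j, poincarePairing Φ₁ e₁ h₁ (b j) (setCycleClass Φ₁ e₁ h₁ (Zt t)) = a j :=
    ae_all_iff.2 fun j ↦ ha j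
  -- the class is determined by its pairings with the basis
  have hdet : ∀ t t', (∀ j, poincarePairing Φ₁ e₁ h₁ (b j) (setCycleClass Φ₁ e₁ h₁ (Zt t)) = a j) →
      (∀ j, poincarePairing Φ₁ e₁ h₁ (b j) (setCycleClass Φ₁ e₁ h₁ (Zt t')) = a j) →
      setCycleClass Φ₁ e₁ h₁ (Zt t) = setCycleClass Φ₁ e₁ h₁ (Zt t') := by
    intro t t' ht ht'
    have hlin : (poincarePairing Φ₁ e₁ h₁).flip (setCycleClass Φ₁ e₁ h₁ (Zt t)) =
        (poincarePairing Φ₁ e₁ h₁).flip (setCycleClass Φ₁ e₁ h₁ (Zt t')) :=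
      b.ext fun j ↦ by simp only [LinearMap.flip_apply, ht j, ht' j]
    rw [← sub_eq_zero]
    refine eq_zero_of_forall_left_poincarePairing_eq_zero Φ₁ e₁ h₁ fun γ ↦ ?_
    have hγ := LinearMap.congr_fun hlin γ
    simp only [LinearMap.flip_apply] at hγ
    rw [map_sub, hγ, sub_self]
  obtain ⟨t₀, ht₀⟩ := hall.exists
  exact ⟨setCycleClass Φ₁ e₁ h₁ (Zt t₀), by
    filter_upwards [hall] with t ht
    exact hdet t t₀ ht ht₀⟩

open Classical in
/-- **THE CLASS OF THE GENERIC FIBRE IS THE RESTRICTION OF THE CLASS: `sign(e₁) cl_{e₁}(Z_t) = i₀^*(sign(e) [Z]_e)`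
for a.e. `t`.** For `Z ⊆ X₁ × X₂` closed analytic of pure dimension `q + dim X₂` (`0 < q`, `0 < dim X₂`)
and codimension `p`, for a.e. `t ∈ E₂` the class of the slice `Z_t ⊆ X₁` (its analytic cycle class when the
slice has pure dimension `q`, `0` when it is empty — a.e. the only two cases) is
`sign(e₁) sign(e) · i₀^*[Z]_e`, the pull-back of the class of `Z` along `i₀ : X₁ → X₁ × X₂`, `x ↦ (x, 0)`
(homotopic to every `i_t : x ↦ (x, t)`; the signs make both sides orientation-free,
`orientationSign_smul_analyticCycleClass`). Fulton: "`α_t = i_t^*(α)`" (Example 10.1.2) with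
"`[𝒱]_t = Σ eᵢ [Wᵢ]`" (Example 10.1.1) and all `eᵢ = 1` at a general `t`; cl commutes with the Gysin
pull-back (§19.2). Proof: by `exists_ae_setCycleClass_fibreSlice_eq` the class is a.e. a constant `R`;
pairing `i₀^*[Z]` with `γ` gives `± ⟨pr₁^*γ ∧ pr₂^*vol, [Z]⟩ = ± vol(e₂,ie₂,…) ∫_{Φ₂[0,1)} ⟨γ, R⟩ dt = ± ⟨γ, R⟩`
(`poincarePairing_compContinuousLinearMap_inl_eq`, the unweighted fibre formula, the normalisation
`vol(e₂,ie₂,…) 𝓗(Φ₂[0,1)^ι₂) = 1`), and Poincaré duality is perfect.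
[cite: Fulton1998, §10.1 Examples 10.1.1–10.1.2 and §19.2 Cor. 19.2 (b)] [cite: Federer1969, 4.3.1–4.3.2]
[cite: King1971, §3] [cite: VoisinHodgeI2002, §11.1.2 Thm. 11.21] -/
theorem ae_setCycleClass_fibreSlice_eq_inl_pullback (hE₂ : 0 < finrank ℂ E₂) {n₁ n q p : ℕ} (e₁ : Fin n₁ ≃ ι₁)
    (e : Fin n ≃ ι₁ ⊕ ι₂) (hq : 0 < q) (h₁ : 2 * q + 2 * p = n₁) (hk : 2 * (q + finrank ℂ E₂) + 2 * p = n)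
    {Z : Set (ComplexTorus (prodPeriodL2 Φ₁ Φ₂))} (hZ : HasPureDim 𝓘(ℂ, WithLp 2 (E₁ × E₂)) Z (q + finrank ℂ E₂)) :
    ∀ᵐ t ∂(μHE[2 * finrank ℂ E₂] : Measure E₂),
      setCycleClass Φ₁ e₁ h₁ {x : ComplexTorus Φ₁ | (prodHomeomorphL2 Φ₁ Φ₂).symm (x, cover Φ₂ t) ∈ Z} =
        ((orientationSign Φ₁ e₁ * orientationSign (prodPeriod Φ₁ Φ₂) e : ℤ) : ℂ) •
          (analyticCycleClass (prodPeriodL2 Φ₁ Φ₂) e hk hZ).compContinuousLinearMap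
            (realRep Φ₁ (prodPeriodL2 Φ₁ Φ₂) (inlMatrix ι₁ ι₂)) := by
  haveI : FiniteDimensional ℝ E₂ := FiniteDimensional.complexToReal E₂
  letI : InnerProductSpace ℝ E₂ := InnerProductSpace.complexToReal
  have hV22 : finrank ℝ E₂ = 2 * finrank ℂ E₂ := by rw [finrank_real_of_complex]
  haveI : (μHE[2 * (finrank ℂ E₂)] : Measure E₂).IsAddHaarMeasure := by
    rw [← hV22, InnerProductSpace.euclideanHausdorffMeasure_eq_volume]; infer_instance
  set Zt : E₂ → Set (ComplexTorus Φ₁) := fun t ↦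
    {x : ComplexTorus Φ₁ | (prodHomeomorphL2 Φ₁ Φ₂).symm (x, cover Φ₂ t) ∈ Z} with hZt
  set s : ℂ := ((orientationSign Φ₁ e₁ * orientationSign (prodPeriod Φ₁ Φ₂) e : ℤ) : ℂ) with hs
  set β := analyticCycleClass (prodPeriodL2 Φ₁ Φ₂) e hk hZ with hβ
  have hss : s * s = 1 := by
    rw [hs, ← Int.cast_mul]
    have h := congrArg₂ (· * ·) (orientationSign_mul_self Φ₁ e₁) (orientationSign_mul_self (prodPeriod Φ₁ Φ₂) e)
    simp only [mul_one] at h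
    rw [show orientationSign Φ₁ e₁ * orientationSign (prodPeriod Φ₁ Φ₂) e *
        (orientationSign Φ₁ e₁ * orientationSign (prodPeriod Φ₁ Φ₂) e) =
        orientationSign Φ₁ e₁ * orientationSign Φ₁ e₁ *
          (orientationSign (prodPeriod Φ₁ Φ₂) e * orientationSign (prodPeriod Φ₁ Φ₂) e) by ring, h, Int.cast_one]
  obtain ⟨R, hR⟩ := exists_ae_setCycleClass_fibreSlice_eq Φ₁ Φ₂ e₁ hq h₁ hZ
  -- orientation of `X₂` in degree `2 dim E₂` and a unitary basis
  have hcard : Fintype.card ι₂ = 2 * finrank ℂ E₂ := by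
    rw [← Module.finrank_fintype_fun_eq_card (R := ℝ), Φ₂.toLinearEquiv.finrank_eq, finrank_real_of_complex]
  set e₂' : Fin (2 * finrank ℂ E₂) ≃ ι₂ := (Fintype.equivFinOfCardEq hcard).symm with he₂'
  set eK : OrthonormalBasis (Fin (finrank ℂ E₂)) ℂ E₂ := stdOrthonormalBasis ℂ E₂ with heK
  have hnorm : volumeForm Φ₂ e₂' (complexFrame ⇑eK) *
      (((μHE[2 * finrank ℂ E₂] : Measure E₂) (periodBox Φ₂ 0)).toReal : ℂ) = 1 := by
    rw [apply_complexFrame_mul_measure_periodBox Φ₂ hE₂ e₂' (volumeForm Φ₂ e₂') eK, torusIntegral_volumeForm]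
  -- `⟨γ, i₀^*β⟩ = s ⟨γ, R⟩` for every `γ`
  have h2 : 2 * q + 2 * finrank ℂ E₂ = 2 * (q + finrank ℂ E₂) := by ring
  have hkh : 2 * q + 2 * finrank ℂ E₂ + 2 * p = n := by omega
  have hpair : ∀ γ : E₁ [⋀^Fin (2 * q)]→L[ℝ] ℂ,
      poincarePairing Φ₁ e₁ h₁ γ (β.compContinuousLinearMap (realRep Φ₁ (prodPeriodL2 Φ₁ Φ₂) (inlMatrix ι₁ ι₂))) =
        s * poincarePairing Φ₁ e₁ h₁ γ R := by
    intro γ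
    rw [poincarePairing_compContinuousLinearMap_inl_eq Φ₁ Φ₂ e₁ e e₂' h₁ hkh γ
      (analyticCycleClass_mem_rationalForms (prodPeriodL2 Φ₁ Φ₂) e hk hZ)]
    congr 1
    -- the pairing with `[Z]` is the period of `Z`, computed by the fibre formula
    have hper : poincarePairing (prodPeriodL2 Φ₁ Φ₂) e hkh
        (((γ.compContinuousLinearMap (ContinuousLinearMap.fst ℝ E₁ E₂)).wedge
            ((volumeForm Φ₂ e₂').compContinuousLinearMap (ContinuousLinearMap.snd ℝ E₁ E₂))).compContinuousLinearMap
          (WithLp.prodContinuousLinearEquiv 2 ℝ E₁ E₂ : WithLp 2 (E₁ × E₂) →L[ℝ] E₁ × E₂)) β =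
        analyticCyclePeriod (prodPeriodL2 Φ₁ Φ₂) hZ
          ((((γ.compContinuousLinearMap (ContinuousLinearMap.fst ℝ E₁ E₂)).wedge
              ((volumeForm Φ₂ e₂').compContinuousLinearMap (ContinuousLinearMap.snd ℝ E₁ E₂))).domDomCongr
            (finCongr h2)).compContinuousLinearMap
            (WithLp.prodContinuousLinearEquiv 2 ℝ E₁ E₂ : WithLp 2 (E₁ × E₂) →L[ℝ] E₁ × E₂)) := by
      rw [hβ, ← poincarePairing_analyticCycleClass (prodPeriodL2 Φ₁ Φ₂) e hk hZ,
        domDomCongr_finCongr_compContinuousLinearMap, poincarePairing_domDomCongr_left']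
    rw [hper, analyticCyclePeriod_cross_eq_integral_fibreSlice Φ₁ Φ₂ hq hZ γ (volumeForm Φ₂ e₂') h2 eK]
    -- the fibre periods are a.e. `⟨γ, R⟩` on the box
    have hae : ∀ᵐ t ∂(μHE[2 * finrank ℂ E₂] : Measure E₂), t ∈ periodBox Φ₂ 0 →
        (if h : HasPureDim 𝓘(ℂ, E₁) (Zt t) q then analyticCyclePeriod Φ₁ h γ else 0) =
          poincarePairing Φ₁ e₁ h₁ γ R := by
      filter_upwards [hR] with t ht _
      rw [← poincarePairing_setCycleClass_eq_dite Φ₁ e₁ h₁ (Zt t) γ, ht]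
    rw [setIntegral_congr_ae (measurableSet_periodBox Φ₂ 0) hae, setIntegral_const, Complex.real_smul,
      ← mul_assoc, measureReal_def, hnorm, one_mul]
  -- conclude by the perfectness of the pairing
  have hRβ : β.compContinuousLinearMap (realRep Φ₁ (prodPeriodL2 Φ₁ Φ₂) (inlMatrix ι₁ ι₂)) = s • R := by
    rw [← sub_eq_zero]
    refine eq_zero_of_forall_left_poincarePairing_eq_zero Φ₁ e₁ h₁ fun γ ↦ ?_
    rw [map_sub, map_smul, hpair γ, smul_eq_mul, sub_self]
  filter_upwards [hR] with t ht
  rw [ht, hRβ, smul_smul, hss, one_smul]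

open Classical in
/-- **THE a.e. DICHOTOMY FOR THE SLICES**: for `Z ⊆ X₁ × X₂` closed analytic of pure dimension `q + dim X₂`
(`0 < q`), EITHER a.e. slice `Z_t` is empty, OR a.e. slice `Z_t` is (non-empty and) of pure dimension
`q` — according as the constant generic class `R` of `exists_ae_setCycleClass_fibreSlice_eq` vanishes or
not (a non-empty analytic subset of pure dimension `q` has a non-zero class, `analyticCycleClass_ne_zero`).
Fulton, App. B.9.2 (Kleiman): the fibre product with a general translate "is either empty or of pure
dimension `dim(Y) + dim(Z) - dim(X)`". [cite: Fulton1998, Appendix B.9.2 and §10.2 Prop. 10.2] -/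
theorem ae_fibreSlice_eq_empty_or_ae_hasPureDim {n₁ q p : ℕ} (e₁ : Fin n₁ ≃ ι₁) (hq : 0 < q)
    (h₁ : 2 * q + 2 * p = n₁) {Z : Set (ComplexTorus (prodPeriodL2 Φ₁ Φ₂))}
    (hZ : HasPureDim 𝓘(ℂ, WithLp 2 (E₁ × E₂)) Z (q + finrank ℂ E₂)) :
    (∀ᵐ t ∂(μHE[2 * finrank ℂ E₂] : Measure E₂),
        {x : ComplexTorus Φ₁ | (prodHomeomorphL2 Φ₁ Φ₂).symm (x, cover Φ₂ t) ∈ Z} = ∅) ∨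
      ∀ᵐ t ∂(μHE[2 * finrank ℂ E₂] : Measure E₂),
        HasPureDim 𝓘(ℂ, E₁) {x : ComplexTorus Φ₁ | (prodHomeomorphL2 Φ₁ Φ₂).symm (x, cover Φ₂ t) ∈ Z} q := by
  haveI : FiniteDimensional ℝ E₂ := FiniteDimensional.complexToReal E₂
  letI : InnerProductSpace ℝ E₂ := InnerProductSpace.complexToReal
  have hV22 : finrank ℝ E₂ = 2 * finrank ℂ E₂ := by rw [finrank_real_of_complex]
  haveI : (μHE[2 * (finrank ℂ E₂)] : Measure E₂).IsAddHaarMeasure := by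
    rw [← hV22, InnerProductSpace.euclideanHausdorffMeasure_eq_volume]; infer_instance
  obtain ⟨R, hR⟩ := exists_ae_setCycleClass_fibreSlice_eq Φ₁ Φ₂ e₁ hq h₁ hZ
  have hgen := ae_hasPureDim_fibreSlice Φ₁ Φ₂ (μHE[2 * finrank ℂ E₂] : Measure E₂) hZ
  by_cases hR0 : R = 0
  · left
    filter_upwards [hR, hgen] with t ht ht'
    rcases ht'.2.2 with h | h
    · exact h
    · exfalso
      rw [setCycleClass_of_hasPureDim Φ₁ e₁ h₁ h, hR0] at ht
      exact analyticCycleClass_ne_zero Φ₁ e₁ h₁ h ht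
  · right
    filter_upwards [hR, hgen] with t ht ht'
    rcases ht'.2.2 with h | h
    · exfalso
      apply hR0
      rw [← ht, setCycleClass, dif_neg]
      intro hp
      exact hp.nonempty.ne_empty h
    · exact h

end Constant

end ComplexTorus

end Literature.Geometry.Kaehler

end
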